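import Summits.QuantumFields.BalabanUV.T4Continuum.Support.ShellMeasurePinnedNorm
import Literature.MathematicalPhysics.QuantumFieldTheory.Balaban1983to89.B7Prop5Flat

/-!
# `T4Continuum.ShellMeasurePostWaveRows` — THREE DISPLAYED ROW FAMILIES OF THE ONE-SLOT END THAT ARE LOGIC OR DEFINITIONS ON
# OUR SIDE: positivity of the dressed integral (`hpos`), the depth of a support (`hdepthw`∕`hdepth`∕`hϖPw`), the Cf-slot reach
# row (`hreachC`) under DESIGNED cell positions — kernel evidence for a post-v5 junction NOTE; touches NO host
(cell `pub-balaban`, sub-cell `t4`, spine estimate NE7c (node U5b); NE7c ROUND-2 crew `t4-ne7c-formalise-*`, unit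
`b2b-balaban-t4-ne7c-formalise-leaf-10` gen 14; journal NOTE N-ne7cL10g14-1 (post-v5 junction candidate per owner R-ne7cp1-g36-12:
«new junction ideas are NOTES until the v5 census»); ADDITIVE — imports S69 `ShellMeasurePinnedNorm` (p223286; `pinDist`,
`pinDist_le_add`, the torus `pl1`) and the Literature leaf `B7Prop5Flat` (`BondIn`, `loK`, `bondHiK`) ONLY; [folklore]; theorems +
`example`s only — 0 `def` (the designed depth and the designed cell are SPELLED AS TERMS, see §2∕§3), 0 `def … : Prop`, 0 sorry, 0 citation
tags.  PRIORITY∕MERGE RECORD: the depth-by-definition and reach-from-metric-reach junctions (§2, the generic half of §3) were noted FIRST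
by leaf-03-g9 — NOTE N-ne7cleaf03g9-1 (journal l.22849, kernel bytes `ShellMeasureCoarsePinGeometry.v1.staged` 8c51969a31fa5a0b:
`pinReach_of_metricReach`, `suppDepth`, `suppDepth_le`∕`_nonneg`, `depthRows_of_suppDepth`); this file carries the MERGED content with
leaf-03-g9's consent (l.23003) under the owner's GO (R-ne7cp1-g37-2 (c)); `hpos` (§1) and the Cf-slot cell computation (§3 `BondIn` ⟹
cell distance ≤ 1) are this seat's)

HONEST FRAMING.  Finite four-torus programme, rung (B)+1 only — NOT infinite volume, NOT a mass gap, NOT the Clay problem, NOT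
summit progress; (B), `BetaPertHyp`, (B^μ) not consumed.  NE7c (`T4IndicatorShell.ShellWeightBound` for the cell's expansions) is
NOT PRINTED in [Balaban 1983–89] and NOT PROVED; «NE7c ⇐ the named binders» (trigger c3).  This file is measure theory 101,
`Finset.inf'` and lattice arithmetic on OUR side: nothing of Bałaban's is asserted, cited or discharged; the census COUNT of the
ONE CALL of record does not move until a host adopts these lemmas (owner's word).  HONEST DEPENDENCY (cell): continuum YM on T⁴ ⇐
BetaPertH ∧ nine spine estimates (0/9 proved); BetaPertH ⇐ (D1) ∧ (D4) ∧ CAP+tail; G-an2-4 gates asym, D1 and NE2/3/4.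

THE POINT (owner census `t4/b2b-balaban-t4-ne7c-p1/ONECALL-CENSUS-NE7c.md` v1.10 §11 + leaf-06-g9's shape lens; link (3)
`ShellMeasureLandauEndAssembledDecayCfLinCoTestsSchurCoarse` binder names).  Among the class-[T] rows projected to survive the
junction wave, three families are not estimates of anything:
* §1 (S78) **`hpos`** `: ∀ V, ∀ x ∈ closedBall 0 S, ∀ c, 1∕2 ≤ c → c ≤ 1 → 0 < ∫ g·e^{A V (c•x)} dμ` (EST-shaped, W-b) is, GIVEN the
  displayed `hg : 0 ≤ g` and `hint` (integrability), EQUIVALENT to ONE field-free condition **`μ (support g) ≠ 0`** («the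
  small-field weight is not a.e. zero»): `integral_mul_exp_pos_iff`, **`hpos_of_support`** (the host's binder shape), and the
  converse **`support_ne_zero_of_hpos`** (so nothing is weakened or strengthened).
* §2 (R15a∕R15b) **`hdepthw`**∕**`hdepth`** `: ∀ p, ∀ b′ ∈ supp p, ϖP p ≤ ϖ b′` + **`hϖPw`** `: 0 ≤ ϖP p`: with the depth DESIGNED as
  the minimal pin depth of the support, the TERM **`suppDepth supp ϖ p := if h : (supp p).Nonempty then (supp p).inf′ h ϖ else 0`** (prose
  name only — spelled out in every statement so the file stays in the kernel lane), both rows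
  are theorems (`suppDepth_le`, `suppDepth_nonneg`) and `suppDepth` is the LARGEST admissible depth on nonempty supports
  (`le_suppDepth`) — so the located counts `hKw`∕`hK`, which keep their displayed form, are the WEAKEST such rows
  (`sum_exp_suppDepth_le`).  Terms with EMPTY support (constant functionals, zero oscillation) are counted at depth `0` — a harmless
  over-count (say so; Bałaban's terms are localized on nonempty sets).
* §3 (R22) **`hreachC`** `: ∀ (c′ : ↥Sw′) (b′ : ↥Sw), BondIn (loK L k c′.1.1) (bondHiK L k c′.1.1 c′.1.2) b′.1.1 b′.1.2 → ϖw (posx c′) −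
  rC ≤ ϖw (pos′ b′)` with S110's pin `ϖw := pinDist Bref` on the cell torus `TPt d Nc`: DESIGN the two Cf-slot position maps —
  the OUTPUT (unit-lattice) bond `c′ = (q, κ)` sits at cell `proj Nc q`, the INPUT (fine) bond `b′ = (y, ν)` at cell
  the TERM **`cellF L k Nc y := proj Nc (fun i => y i ∕ L^k)`** (floor division; prose name only) — then `BondIn` (the fine bond lies in `B^k(c′₋) ∪ B^k(c′₊)`,
  [Balaban1985Averaging] p. 24 locality, S99's exact stencil) forces `pl1 (proj Nc q − cellF y) ≤ 1` (`pl1_cell_sub_le_one_of_bondIn`),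
  hence the reach row for EVERY `rC ≥ 1` (**`hreachC_of_cells`**, via S69 `pinDist_le_add`; the generic metric form — leaf-03-g9's
  `pinReach_of_metricReach` shape — is `pinDist_sub_le_of_pl1_le`); the letter `rC` stays (it sits in
  `hk`'s `e^{δw·rC}` and the conclusion) with ONE number row `1 ≤ rC`.  The e-leg's [R] twin `hreache`∕`hϖe₁`∕`hϖe₂` follows the
  same way (`hreache_of_cells`).
EXPECTED CENSUS EFFECT if a post-v5 host adopts §1–§3 (owner's two engines decide; conclusion IDENTICAL): LEAVING `hpos` (EST),
`hdepthw hdepth hreachC` (GEO), `hϖPw` (SGN) + data `ϖPw ϖP posx pos′` (+ [R] `hϖe₁ hϖe₂ hreache`, data `ϖe₁ ϖe₂` if the e-leg twin is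
taken); ENTERING `hgs : μ (support g) ≠ 0` [S], `hrC : 1 ≤ rC` [N] (+ `hr₀e : 1 ≤ r₀e`).  NOT touched: every W-a∕W-b∕W-h∕W-i estimate
row, `hK`∕`hKw` (kept verbatim over the designed depths), `hk` (ROW S112's business), the read-out rows (ROW S109's), the
restriction letters (NOTES N-ne7cL05g11-1 ∕ N-ne7cleaf01g11-1), the e-tuple (O-ne7cleaf01g11-1).
NOTHING in the countdown moves; NE7c NOT PROVED; spine PROVED 0∕9.
-/

noncomputable section

open Set Metric MeasureTheory Function

namespace Summit.QuantumFields.BalabanUV.T4Continuum.ShellMeasurePostWaveRows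

open Literature.MathematicalPhysics.QuantumFieldTheory.Balaban1983to89
open ShellMeasurePinnedNorm (pinDist pinDist_nonneg pinDist_le_add)
open TreeLengthTorus (TPt proj)
open B12Decay510Torus (pl1 pl1_nonneg pl1_proj_le_l1 proj_sub)
open B12Sec2to5 (l1)
open B7Prop1Local (loK bondHiK InBox)
open B7Prop5Flat (BondIn)

export B7Prop1Explicit (Site)

/-! ## §1 (S78) Positivity of the dressed integral is ONE field-free condition -/

section Positivity

variable {Ω : Type*} [MeasurableSpace Ω] (μ : Measure Ω) {g : Ω → ℝ}

omit [MeasurableSpace Ω] in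
/-- The support of `g·e^{A}` is the support of `g`. [folklore] -/
theorem support_mul_exp (g A : Ω → ℝ) : support (fun ω => g ω * Real.exp (A ω)) = support g := by
  ext ω
  simp only [mem_support, ne_eq, mul_eq_zero, (Real.exp_pos _).ne', or_false]

/-- **`0 < ∫ g·e^{A} dμ ↔ 0 < μ (support g)`** for `g ≥ 0` and an integrable dressed weight (Mathlib's
`integral_pos_iff_support_of_nonneg` + `support_mul_exp`). [folklore] -/
theorem integral_mul_exp_pos_iff (hg : ∀ ω, 0 ≤ g ω) (A : Ω → ℝ)
    (hint : Integrable (fun ω => g ω * Real.exp (A ω)) μ) :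
    (0 < ∫ ω, g ω * Real.exp (A ω) ∂μ) ↔ 0 < μ (support g) := by
  rw [integral_pos_iff_support_of_nonneg (fun ω => mul_nonneg (hg ω) (Real.exp_pos _).le) hint, support_mul_exp]

variable {GF X : Type*} [SeminormedAddCommGroup X] [NormedSpace ℝ X]

/-- **THE END's ROW `hpos` FROM ONE FIELD-FREE CONDITION** (the host's binder shape, S80 f3 ff. (S78)): if the weight `g ≥ 0` is
not `μ`-a.e. zero and the dressed weights are integrable (`hint`), every dressed integral along every contraction ray is
positive. [folklore] -/
theorem hpos_of_support (hg : ∀ ω, 0 ≤ g ω) (hgs : μ (support g) ≠ 0) (A : GF → X → Ω → ℝ) {S : ℝ}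
    (hint : ∀ V, ∀ x ∈ closedBall (0 : X) S, ∀ c : ℝ, 1 / 2 ≤ c → c ≤ 1 →
      Integrable (fun ω => g ω * Real.exp (A V (c • x) ω)) μ) :
    ∀ V, ∀ x ∈ closedBall (0 : X) S, ∀ c : ℝ, 1 / 2 ≤ c → c ≤ 1 →
      0 < ∫ ω, g ω * Real.exp (A V (c • x) ω) ∂μ :=
  fun V x hx c hc hc1 =>
    (integral_mul_exp_pos_iff μ hg (A V (c • x)) (hint V x hx c hc hc1)).2 (pos_iff_ne_zero.2 hgs)

/-- **THE CONVERSE** (nothing is weakened): if some dressed integral is positive — e.g. the row `hpos` at any `V`, the centre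
`x = 0 ∈ closedBall 0 S` (`0 ≤ S`) and `c = 1` — then `μ (support g) ≠ 0`. [folklore] -/
theorem support_ne_zero_of_integral_pos (hg : ∀ ω, 0 ≤ g ω) {A : Ω → ℝ}
    (hint : Integrable (fun ω => g ω * Real.exp (A ω)) μ) (hpos : 0 < ∫ ω, g ω * Real.exp (A ω) ∂μ) :
    μ (support g) ≠ 0 :=
  (pos_iff_ne_zero.1 ((integral_mul_exp_pos_iff μ hg A hint).1 hpos))

/-- **`hpos` ⟹ `μ (support g) ≠ 0`** in the host's binder shape (needs one exterior section `V₀` and `0 ≤ S`). [folklore] -/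
theorem support_ne_zero_of_hpos (hg : ∀ ω, 0 ≤ g ω) (A : GF → X → Ω → ℝ) {S : ℝ} (hS : 0 ≤ S) (V₀ : GF)
    (hint : ∀ V, ∀ x ∈ closedBall (0 : X) S, ∀ c : ℝ, 1 / 2 ≤ c → c ≤ 1 →
      Integrable (fun ω => g ω * Real.exp (A V (c • x) ω)) μ)
    (hpos : ∀ V, ∀ x ∈ closedBall (0 : X) S, ∀ c : ℝ, 1 / 2 ≤ c → c ≤ 1 →
      0 < ∫ ω, g ω * Real.exp (A V (c • x) ω) ∂μ) :
    μ (support g) ≠ 0 := by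
  have h0 : (0 : X) ∈ closedBall (0 : X) S := mem_closedBall_self hS
  exact support_ne_zero_of_integral_pos μ hg (hint V₀ 0 h0 1 (by norm_num) le_rfl) (hpos V₀ 0 h0 1 (by norm_num) le_rfl)

end Positivity

/-! ## §2 (R15a∕R15b) The depth of a support is a definition -/

section Depth

variable {𝔱 Λ : Type*}

/-! The DESIGNED DEPTH of an index `i` with finite support `supp i` under a pin `ϖ` is the TERM
`if h : (supp i).Nonempty then (supp i).inf' h ϖ else 0` («`suppDepth supp ϖ i`» in prose; leaf-03-g9's N-ne7cleaf03g9-1 names it the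
same) — the minimal pin depth over the support, `0` on an empty support.  No `def`: hosts spell the term. -/

/-- **THE ROW `hdepth`∕`hdepthw` IS A THEOREM** for the designed depth: `suppDepth supp ϖ i ≤ ϖ b′` for `b′ ∈ supp i`. [folklore] -/
theorem suppDepth_le (supp : 𝔱 → Finset Λ) (ϖ : Λ → ℝ) {i : 𝔱} {b' : Λ} (hb' : b' ∈ supp i) :
    (if h : (supp i).Nonempty then (supp i).inf' h ϖ else 0) ≤ ϖ b' := by
  rw [dif_pos ⟨b', hb'⟩]
  exact Finset.inf'_le _ hb'

/-- The host-shaped family form of `hdepth` (`∀ i ∈ I, ∀ b′ ∈ supp i, ϖP i ≤ ϖ b′`). [folklore] -/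
theorem hdepth_of_suppDepth (I : Finset 𝔱) (supp : 𝔱 → Finset Λ) (ϖ : Λ → ℝ) :
    ∀ i ∈ I, ∀ b' ∈ supp i, (if h : (supp i).Nonempty then (supp i).inf' h ϖ else 0) ≤ ϖ b' :=
  fun _ _ _ hb' => suppDepth_le supp ϖ hb'

/-- **THE SIGN ROW `hϖPw` IS A THEOREM**: a nonnegative pin has nonnegative designed depths. [folklore] -/
theorem suppDepth_nonneg (supp : 𝔱 → Finset Λ) {ϖ : Λ → ℝ} (hϖ : ∀ b', 0 ≤ ϖ b') (i : 𝔱) :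
    0 ≤ (if h : (supp i).Nonempty then (supp i).inf' h ϖ else 0) := by
  split_ifs with h
  · exact Finset.le_inf' _ _ fun b' _ => hϖ b'
  · exact le_rfl

/-- **MAXIMALITY**: any displayed depth obeying the row `hdepth` is below the designed one on a nonempty support. [folklore] -/
theorem le_suppDepth (supp : 𝔱 → Finset Λ) (ϖ : Λ → ℝ) {ϖP : 𝔱 → ℝ} {i : 𝔱} (hne : (supp i).Nonempty)
    (hdepth : ∀ b' ∈ supp i, ϖP i ≤ ϖ b') :
    ϖP i ≤ (if h : (supp i).Nonempty then (supp i).inf' h ϖ else 0) := by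
  rw [dif_pos hne]
  exact Finset.le_inf' _ _ hdepth

/-- **THE LOCATED COUNT IS WEAKEST AT THE DESIGNED DEPTH**: for `0 ≤ δ`, nonnegative per-index sizes `a i` and nonempty supports,
any displayed pair (`ϖP`, `hdepth`) with `Σ a·e^{−δ·ϖP} ≤ K` gives the same row for `suppDepth`. [folklore] -/
theorem sum_exp_suppDepth_le (I : Finset 𝔱) (supp : 𝔱 → Finset Λ) (ϖ : Λ → ℝ) {δ : ℝ} (hδ : 0 ≤ δ)
    {a : 𝔱 → ℝ} (ha : ∀ i ∈ I, 0 ≤ a i) {ϖP : 𝔱 → ℝ} (hne : ∀ i ∈ I, (supp i).Nonempty)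
    (hdepth : ∀ i ∈ I, ∀ b' ∈ supp i, ϖP i ≤ ϖ b') {K : ℝ}
    (hK : ∑ i ∈ I, a i * Real.exp (-(δ * ϖP i)) ≤ K) :
    ∑ i ∈ I, a i * Real.exp (-(δ * (if h : (supp i).Nonempty then (supp i).inf' h ϖ else 0))) ≤ K := by
  refine le_trans (Finset.sum_le_sum fun i hi => ?_) hK
  refine mul_le_mul_of_nonneg_left (Real.exp_le_exp.2 ?_) (ha i hi)
  have := le_suppDepth supp ϖ (hne i hi) (hdepth i hi)
  nlinarith

end Depth

/-! ## §3 (R22) The Cf-slot reach row under DESIGNED cell positions -/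

section Cells

variable {d : ℕ}

/-! The CELL OF A FINE SITE `y` at level `k` on the cell torus `(ℤ∕Ncℤ)^d` is the TERM `proj Nc (fun i => y i / L^k)` («`cellF L k Nc
y`» in prose): floor-divide the fine coordinates by `L^k` (the unit-lattice site `q` with `y ∈ B^k(q)`; [Balaban1985Averaging] p. 24
dictionary `loK L k q = L^k q` — a locator, not a citation) and project.  No `def`: hosts spell the term. -/

/-- **`BondIn` PINS THE CELL**: if the fine site `y` lies in the box `B^k(c₋) ∪ B^k(c₊)` of the unit bond `c = (q, κ)`
(`InBox (loK L k q) (bondHiK L k q κ) y`), then coordinatewise `y_i ∕ L^k − q_i ∈ {0, [i = κ]}`. [folklore] -/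
theorem floor_sub_of_inBox {L : ℕ} (hL : 1 ≤ L) (k : ℕ) {q y : Site d} {κ : Fin d}
    (h : InBox (loK L k q) (bondHiK L k q κ) y) (i : Fin d) :
    0 ≤ y i / (L : ℤ) ^ k - q i ∧ y i / (L : ℤ) ^ k - q i ≤ if i = κ then 1 else 0 := by
  have hP : (0 : ℤ) < (L : ℤ) ^ k := by positivity
  obtain ⟨h1, h2⟩ := h i
  simp only [loK, bondHiK] at h1 h2
  constructor
  · have : q i ≤ y i / (L : ℤ) ^ k := (Int.le_ediv_iff_mul_le hP).2 (by linarith [mul_comm ((L : ℤ) ^ k) (q i)])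
    linarith
  · have hlt : y i < (q i + 1 + if i = κ then 1 else 0) * (L : ℤ) ^ k := by
      split_ifs at h2 ⊢ <;> nlinarith
    have : y i / (L : ℤ) ^ k < q i + 1 + if i = κ then 1 else 0 := (Int.ediv_lt_iff_lt_mul hP).2 hlt
    split_ifs at this ⊢ <;> omega

/-- **THE CELL DISTANCE UNDER `BondIn` IS AT MOST ONE**: `pl1 (proj Nc q − cellF L k Nc y) ≤ 1`. [folklore] -/
theorem pl1_cell_sub_le_one_of_bondIn {L : ℕ} (hL : 1 ≤ L) (k Nc : ℕ) [NeZero Nc] {q y : Site d} {κ ν : Fin d}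
    (h : BondIn (loK L k q) (bondHiK L k q κ) y ν) :
    pl1 (proj Nc q - proj Nc (fun i => y i / (L : ℤ) ^ k)) ≤ 1 := by
  have hin := h.1
  rw [← proj_sub]
  refine (pl1_proj_le_l1 _).trans ?_
  unfold B12Sec2to5.l1
  have hco : ∀ i, |((q - fun i => y i / (L : ℤ) ^ k) i : ℝ)| ≤ if i = κ then 1 else 0 := fun i => by
    obtain ⟨h0, h1⟩ := floor_sub_of_inBox hL k hin i
    simp only [Pi.sub_apply, Int.cast_sub]
    rw [abs_sub_comm, abs_of_nonneg (by exact_mod_cast h0)]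
    split_ifs at h1 ⊢ <;> exact_mod_cast h1
  calc ∑ i, |((q - fun i => y i / (L : ℤ) ^ k) i : ℝ)| ≤ ∑ i : Fin d, (if i = κ then (1 : ℝ) else 0) :=
        Finset.sum_le_sum fun i _ => hco i
    _ = 1 := by simp

variable {Nc : ℕ} [NeZero Nc] in
/-- **REACH FROM METRIC REACH** (the generic half; leaf-03-g9's `pinReach_of_metricReach` shape): a stencil whose pairs are within
cell distance `r` satisfies the pinned reach row for S69's pin. [folklore] -/
theorem pinDist_sub_le_of_pl1_le (Bref : Finset (TPt d Nc)) (hBref : Bref.Nonempty) {x y : TPt d Nc} {r : ℝ}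
    (h : pl1 (x - y) ≤ r) : pinDist Bref hBref x - r ≤ pinDist Bref hBref y := by
  have := pinDist_le_add Bref hBref x y
  linarith

/-- **THE END's ROW `hreachC` IS A THEOREM FOR DESIGNED POSITIONS** (link (3)'s shape with S110's pin `pinDist Bref` on
`TPt d Nc`, S99's stencil `BondIn (loK L k c′.1.1) (bondHiK L k c′.1.1 c′.1.2)`): output bond `c′` at cell `proj Nc c′.1.1`,
input bond `b′` at cell `cellF L k Nc b′.1.1`; ANY reach `rC ≥ 1`. [folklore] -/
theorem hreachC_of_cells {L : ℕ} (hL : 1 ≤ L) (k Nc : ℕ) [NeZero Nc] (Bref : Finset (TPt d Nc)) (hBref : Bref.Nonempty)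
    (Sw Sw' : Finset (Site d × Fin d)) {rC : ℝ} (hrC : 1 ≤ rC) :
    ∀ (c' : ↥Sw') (b' : ↥Sw), BondIn (loK L k c'.1.1) (bondHiK L k c'.1.1 c'.1.2) b'.1.1 b'.1.2 →
      pinDist Bref hBref (proj Nc c'.1.1) - rC ≤ pinDist Bref hBref (proj Nc fun i => b'.1.1 i / (L : ℤ) ^ k) := by
  intro c' b' hb
  have h1 := pl1_cell_sub_le_one_of_bondIn hL k Nc hb
  have h2 := pinDist_le_add Bref hBref (proj Nc c'.1.1) (proj Nc fun i => b'.1.1 i / (L : ℤ) ^ k)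
  linarith

/-- **THE e-LEG's [R] TWIN `hreache`** (same stencil, pins `ϖe₂ := pinDist ∘ proj`, `ϖe₁ := pinDist ∘ cellF`, ANY `r₀e ≥ 1`);
the sign rows `hϖe₁ hϖe₂` are `pinDist_nonneg`. [folklore] -/
theorem hreache_of_cells {L : ℕ} (hL : 1 ≤ L) (k Nc : ℕ) [NeZero Nc] (Bref : Finset (TPt d Nc)) (hBref : Bref.Nonempty)
    (Se Se' : Finset (Site d × Fin d)) {r₀e : ℝ} (hr₀e : 1 ≤ r₀e) :
    ∀ (c : ↥Se') (s : ↥Se), BondIn (loK L k c.1.1) (bondHiK L k c.1.1 c.1.2) s.1.1 s.1.2 →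
      pinDist Bref hBref (proj Nc c.1.1) - r₀e ≤ pinDist Bref hBref (proj Nc fun i => s.1.1 i / (L : ℤ) ^ k) :=
  hreachC_of_cells hL k Nc Bref hBref Se Se' hr₀e

end Cells

/-! ## §4 Non-vacuity (crew rule G-1): the entering rows are jointly inhabited, non-degenerately -/

section NonVacuity

/-- `μ (support g) ≠ 0` for the constant weight `g ≡ 1` under any nonzero measure (e.g. a Dirac mass), together with the
host's `hg`. [folklore] -/
example {Ω : Type*} [MeasurableSpace Ω] (μ : Measure Ω) [NeZero μ] :
    (∀ ω : Ω, (0 : ℝ) ≤ 1) ∧ μ (support fun _ : Ω => (1 : ℝ)) ≠ 0 := by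
  refine ⟨fun _ => zero_le_one, ?_⟩
  rw [Function.support_const one_ne_zero]
  exact MeasureTheory.Measure.measure_univ_ne_zero.2 (NeZero.ne μ)

/-- the number rows `1 ≤ rC`, `1 ≤ r₀e` at `rC = r₀e = 1`, and a designed depth computed: support `{0, 1}` with pins `3, 5` has
depth `3`. [folklore] -/
example : (1 : ℝ) ≤ 1 ∧
    (if h : ((fun _ : Unit => ({0, 1} : Finset ℕ)) ()).Nonempty
      then ((fun _ : Unit => ({0, 1} : Finset ℕ)) ()).inf' h (fun n => if n = 0 then (3 : ℝ) else 5) else 0) = 3 := by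
  refine ⟨le_rfl, le_antisymm ?_ ?_⟩
  · exact (suppDepth_le (fun _ : Unit => ({0, 1} : Finset ℕ)) (fun n => if n = 0 then (3 : ℝ) else 5) (i := ())
      (b' := 0) (by simp)).trans_eq (if_pos rfl)
  · exact le_suppDepth (fun _ : Unit => ({0, 1} : Finset ℕ)) (fun n => if n = 0 then (3 : ℝ) else 5) (ϖP := fun _ => 3)
      (i := ()) (by simp) fun b' _ => by split_ifs <;> norm_num

/-- a fine bond in the block pair of a unit bond (d = 2, L = 2, k = 1: unit bond `((1,1), 0)`, box `[2, 5] × [2, 3]`, fine bond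
`((4, 3), 0)`; cells `(1,1)` vs `(2,1)` — distance exactly `1`). [folklore] -/
example : BondIn (loK 2 1 (![1, 1] : Site 2)) (bondHiK 2 1 (![1, 1] : Site 2) 0) (![4, 3] : Site 2) 0 := by
  refine ⟨fun i => ?_, fun i => ?_⟩ <;> fin_cases i <;> simp [loK, bondHiK, B7Prop1Explicit.e_apply]

end NonVacuity

end Summit.QuantumFields.BalabanUV.T4Continuum.ShellMeasurePostWaveRows

end
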